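import Summits.ABC.IUTFork.Conditional.AbcOfSGenuineKChosenDepthRadTriple
import Summits.ABC.IUTFork.Cor312GenuineKTwistLowerBound
import HarnessLib

/-!
# [IUTchIII] Cor. 3.12, branch C / R-W window table — the EXACT tame local type at the `K`-level pilot datum over a rational
# pole of `j`, `p ∉ {2, 3, 5, l}`: `e(K_{x₀}/ℚ_p) = 2·(15/gcd(15,t))·l` under the model twist clause, `∈ {15·l, 30·l}` without it

PROOF-ONLY support file (D-0012; 0 definitions, 0 `Prop` facts) of the abc-iut cell (R-W «WINDOW Θ-SIDE INEQUALITY», seat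
abc-iut-W-neg-2 gen 2, row «W:LOCAL-TYPE-LB-FIBRE»). TAKES NO SIDE on [IUTchIII] Cor. 3.12 (S. Mochizuki, *Inter-universal
Teichmüller theory III*, RIMS manuscript, Cor. 3.12 p. 173–174) or on any author.

The W1 ROW DECISIONS of the R-W window table (abc-iut-W-row-1's `WRow.licence_frey283_thirteen` p475489, …) carry the TABULATED
local type at each bad prime as a HYPOTHESIS `e(K_{x₀}/ℚ_p) = e₀`. At a TAME pole `p ∉ {2,3,5,l}` of `j(λ)` of order `2t` the tree
now holds BOTH bounds — UPPER: `e ∣ 30·l` (abc-iut-W-neg-1 p462053 `GenuineK.absRamificationIdx_kOf_dvd_thirty_mul_ratPoint`),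
`e ∣ 10·l` if `3 ∣ t`, `e ∣ 6·l` if `5 ∣ t`, `e ∣ 2·l` if `15 ∣ t` (abc-iut-W-ref-2 / w5-d236 `…_dvd_ten/_six/_two_mul_ratPoint`,
Tate-exact); LOWER: `15·l ∣ e·t`, `l ∣ e` (abc-iut-W-neg-1 p467688) and the twist factor `2 ∣ e` under the MODEL clause `√y ∈ F`,
`ord_p(y)` odd (this seat's p475369). This file closes the sandwich:

* `Conditional.GenuineK.absRamificationIdx_kOf_eq_thirty_mul_of_isSquare` — `gcd(15,t) = 1` + twist clause ⟹ **`e = 30·l`**;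
* `Conditional.GenuineK.absRamificationIdx_kOf_eq_ten_mul_of_isSquare` — `3 ∣ t`, `5 ∤ t` + twist clause ⟹ **`e = 10·l`**
  (e.g. `e = 130` over `17` at `283 + 5¹¹·13² = 2⁸·3⁸·17³`, `l = 13`: hypothesis `hloc17` of p475489 modulo the model clause);
* `Conditional.GenuineK.absRamificationIdx_kOf_eq_six_mul_of_isSquare` — `5 ∣ t`, `3 ∤ t` + twist clause ⟹ **`e = 6·l`**;
* `Conditional.GenuineK.absRamificationIdx_kOf_eq_two_mul_of_isSquare` — `15 ∣ t` + twist clause ⟹ **`e = 2·l`**;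
* `Conditional.GenuineK.absRamificationIdx_kOf_eq_fifteen_mul_or_eq_thirty_mul` — `gcd(15,t) = 1`, NO model clause ⟹
  **`e = 15·l ∨ e = 30·l`** (the numerics' two Kummer candidates, e.g. `{195, 390}` over `283` at the row above).

The twist clause `IsSquare (algebraMap F_tpd F y)` with `ord_p(y)` odd is satisfied in the cell's model reading `F = F‡(P) ∋ √λ,
√(λ−1)` (`y = λ` at `p ∣ a·c`, `y = λ−1` at `p ∣ b`, `t = v_p(abc)` odd); it is NOT a consequence of the typed datum
(`Cor312GenuineKTwistLowerBound`). HONEST FRAMING: bookkeeping over OUR typed objects; nothing here bears on the printed inequality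
of [IUTchIII] Cor. 3.12 or on the number-level `Cor22.Cor312AtDatum`; typed ≠ proved; instantiated ≠ endorsed.
[cite: Mochizuki2012, IUTchI Ex. 3.2 (iv) p. 71; IUTchIV Thm. 1.10 proof Steps (ii)–(iii) p. 24–26, Cor. 2.2 (ii) proof (P5) p. 46]
[cite: SerreLocalFields1979, Ch. IV §2 Cor. 1 of Prop. 7] [cite: SilvermanATAEC1994, V.5 Thm. 5.3 and Cor. 5.4]
[claim: Mochizuki2012, status: disputed] for every IUT quotation.
-/

noncomputable section

open NumberField IsDedekindDomain

namespace Summit.ABC.IUTFork.Conditional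

open Thm311 Thm311.Real Cor312 Cor312Prov Literature.IUT.LogVolume Literature.IUT.HodgeTheaters
  Literature.IUT.LogThetaLattice Literature.NumberTheory.NumberFields Literature.NumberTheory.DiophantineGeometry.GenEll
  Literature.NumberTheory.DiophantineGeometry

/-- Arithmetic glue: `l ∣ e`, `a·l ∣ e`, `15·l ∣ e·t`, `b ∣ 15`, `gcd(b,t) = 1`, `gcd(a,b) = 1` ⟹ `a·b·l ∣ e`. [folklore] -/
private theorem mul_mul_dvd_of_sandwich {a b l e t : ℕ} (hl : 0 < l) (hle : l ∣ e) (ha : a * l ∣ e)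
    (h15 : 15 * l ∣ e * t) (hb : b ∣ 15) (hbt : Nat.Coprime b t) (hab : Nat.Coprime a b) : a * b * l ∣ e := by
  obtain ⟨e₁, rfl⟩ := hle
  have ha' : a ∣ e₁ := by
    have : l * a ∣ l * e₁ := by rw [mul_comm l a]; exact ha
    exact Nat.dvd_of_mul_dvd_mul_left hl this
  have h15' : 15 ∣ e₁ * t := by
    have : l * 15 ∣ l * (e₁ * t) := by rw [mul_comm l 15, ← mul_assoc]; exact h15
    exact Nat.dvd_of_mul_dvd_mul_left hl this
  have hb' : b ∣ e₁ := hbt.dvd_of_dvd_mul_right (hb.trans h15')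
  rw [show a * b * l = l * (a * b) by ring]
  exact mul_dvd_mul_left l (hab.mul_dvd_of_dvd_of_dvd ha' hb')

/-- Arithmetic glue: `m ∣ e ∣ 2m` and `m > 0` ⟹ `e = m ∨ e = 2m`. [folklore] -/
private theorem eq_or_eq_two_mul_of_dvd_of_dvd {m e : ℕ} (hm : 0 < m) (h1 : m ∣ e) (h2 : e ∣ 2 * m) :
    e = m ∨ e = 2 * m := by
  obtain ⟨k, rfl⟩ := h1
  have hk2 : k ∣ 2 := by
    have : m * k ∣ m * 2 := by rw [mul_comm m 2]; exact h2
    exact Nat.dvd_of_mul_dvd_mul_left hm this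
  have hkle : k ≤ 2 := Nat.le_of_dvd (by norm_num) hk2
  have hk0 : k ≠ 0 := by
    rintro rfl
    simp at hk2
  have hk : k = 1 ∨ k = 2 := by omega
  rcases hk with rfl | rfl
  · left; ring
  · right; ring

section Tame

variable {q : ℚ} {l : ℕ} (T : Cor22.ThetaVolumeDatumAt (ratPoint q) l)
  (pp : Nat.Primes) (hp2 : (pp : ℕ) ≠ 2) (hp3 : (pp : ℕ) ≠ 3) (hp5 : (pp : ℕ) ≠ 5) (hpl : (pp : ℕ) ≠ l) {t : ℕ} (ht : 0 < t)
  (hpole : ∀ v : HeightOneSpectrum (𝓞 ℚ), Rat.HeightOneSpectrum.natGenerator v = pp →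
    Literature.IUT.LogVolume.ord ℚ v (Cor22.jInv q) = -(2 * (t : ℤ)))

include hp2 hp3 hp5 hpl ht hpole

omit hp2 hp3 hp5 hpl in
/-- A pole of order `2t ≥ 2` is a pole: `ord_p j(q) = −2t < 0`. [folklore] -/
private theorem pole_neg : ∀ v : HeightOneSpectrum (𝓞 ℚ), Rat.HeightOneSpectrum.natGenerator v = pp →
    Literature.IUT.LogVolume.ord ℚ v (Cor22.jInv q) < 0 := fun v hv => by
  rw [hpole v hv]
  have : (0 : ℤ) < t := by exact_mod_cast ht
  linarith

/-- **EXACT tame type, generic class: `gcd(15, t) = 1` and the twist clause ⟹ `e(K_{x₀}/ℚ_p) = 30·l`** at every fibre point over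
a rational pole `p ∉ {2,3,5,l}` of `j` of order `2t` (sandwich `30·l ∣ e ∣ 30·l`: abc-iut-W-neg-1's `…_dvd_thirty_mul_ratPoint` above,
`15·l ∣ e` and the twist factor `2` below). [cite: Mochizuki2012, IUTchIV Thm. 1.10 proof Steps (ii)–(iii) p. 24–26]
[cite: SerreLocalFields1979, Ch. IV §2 Cor. 1 of Prop. 7] [claim: Mochizuki2012, status: disputed] -/
theorem GenuineK.absRamificationIdx_kOf_eq_thirty_mul_of_isSquare (hcop : Nat.Coprime 15 t)
    {y : ℚ} (hsq : letI := T.instFieldF; letI := T.instAlgebraF; IsSquare (algebraMap (ratPoint q).F T.F y))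
    (hodd : ∀ v : HeightOneSpectrum (𝓞 ℚ), Rat.HeightOneSpectrum.natGenerator v = pp → Odd (Literature.IUT.LogVolume.ord ℚ v y)) :
    letI := T.instFieldF; letI := T.instNumberFieldF; letI := T.instAlgebraF; letI := T.instFieldK
    letI := T.instNumberFieldK; letI := T.instAlgebraK; letI := T.instFieldFbar; letI := T.instAlgebraFbar
    letI := T.instAlgebraKFbar; letI := T.instIsElliptic
    haveI : Fact (pp : ℕ).Prime := ⟨pp.2⟩
    ∀ x₀ : (thetaIndex (pilotDataOfK T.D T.K)).Fibre (.inr pp),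
      absRamificationIdx (pp : ℕ) (kOf (pilotDataOfK T.D T.K) pp.1 x₀) = 30 * l := by
  letI := T.instFieldF; letI := T.instNumberFieldF; letI := T.instAlgebraF; letI := T.instFieldK
  letI := T.instNumberFieldK; letI := T.instAlgebraK; letI := T.instFieldFbar; letI := T.instAlgebraFbar
  letI := T.instAlgebraKFbar; letI := T.instIsElliptic
  haveI : Fact (pp : ℕ).Prime := ⟨pp.2⟩
  intro x₀
  have hpole' := pole_neg pp ht hpole
  have hup := (GenuineK.absRamificationIdx_kOf_dvd_thirty_mul_ratPoint T pp hp2 hp3 hp5 hpl hpole' x₀).1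
  have h15 := GenuineK.fifteen_mul_prime_dvd_absRamificationIdx_kOf_ratPoint_of_coprime T pp hp2 hpl ht hcop hpole x₀
  have h2 := GenuineK.two_mul_prime_dvd_absRamificationIdx_kOf_of_isSquare T pp hp2 hpl hpole' hsq hodd x₀
  have hle := GenuineK.prime_dvd_absRamificationIdx_kOf_ratPoint T pp hp2 hpl hpole' x₀
  have hlow := mul_mul_dvd_of_sandwich (a := 2) (b := 15) (t := 1) T.D.l_prime.pos hle h2 (by simpa using h15) dvd_rfl
    (Nat.coprime_one_right 15) (by norm_num)
  exact Nat.dvd_antisymm hup (by simpa [show 2 * 15 * l = 30 * l by ring] using hlow)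

/-- **EXACT tame type, class `3 ∣ t`, `5 ∤ t`, with the twist clause ⟹ `e(K_{x₀}/ℚ_p) = 10·l`** (sandwich: Tate-exact `e ∣ 10·l`,
abc-iut-w5-d236's `…_dvd_ten_mul_ratPoint`, against `5·l ∣ e` from the Tate root and the twist factor `2`). Example: `e = 130` over `17`
at the R-W row `283 + 5¹¹·13² = 2⁸·3⁸·17³`, `l = 13` (`t = 3`). [cite: SilvermanATAEC1994, V.5 Thm. 5.3 and Cor. 5.4]
[cite: Mochizuki2012, IUTchI Ex. 3.2 (iv) p. 71] [claim: Mochizuki2012, status: disputed] -/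
theorem GenuineK.absRamificationIdx_kOf_eq_ten_mul_of_isSquare (h3 : 3 ∣ t) (h5t : Nat.Coprime 5 t)
    {y : ℚ} (hsq : letI := T.instFieldF; letI := T.instAlgebraF; IsSquare (algebraMap (ratPoint q).F T.F y))
    (hodd : ∀ v : HeightOneSpectrum (𝓞 ℚ), Rat.HeightOneSpectrum.natGenerator v = pp → Odd (Literature.IUT.LogVolume.ord ℚ v y)) :
    letI := T.instFieldF; letI := T.instNumberFieldF; letI := T.instAlgebraF; letI := T.instFieldK
    letI := T.instNumberFieldK; letI := T.instAlgebraK; letI := T.instFieldFbar; letI := T.instAlgebraFbar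
    letI := T.instAlgebraKFbar; letI := T.instIsElliptic
    haveI : Fact (pp : ℕ).Prime := ⟨pp.2⟩
    ∀ x₀ : (thetaIndex (pilotDataOfK T.D T.K)).Fibre (.inr pp),
      absRamificationIdx (pp : ℕ) (kOf (pilotDataOfK T.D T.K) pp.1 x₀) = 10 * l := by
  letI := T.instFieldF; letI := T.instNumberFieldF; letI := T.instAlgebraF; letI := T.instFieldK
  letI := T.instNumberFieldK; letI := T.instAlgebraK; letI := T.instFieldFbar; letI := T.instAlgebraFbar
  letI := T.instAlgebraKFbar; letI := T.instIsElliptic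
  haveI : Fact (pp : ℕ).Prime := ⟨pp.2⟩
  intro x₀
  have hpole' := pole_neg pp ht hpole
  have hord3 : ∀ v : HeightOneSpectrum (𝓞 ℚ), Rat.HeightOneSpectrum.natGenerator v = pp →
      (3 : ℤ) ∣ Literature.IUT.LogVolume.ord ℚ v (Cor22.jInv q) := fun v hv => by
    obtain ⟨t', ht'⟩ := h3
    refine ⟨-(2 * (t' : ℤ)), ?_⟩
    rw [hpole v hv, ht']; push_cast; ring
  have hup := GenuineK.absRamificationIdx_kOf_dvd_ten_mul_ratPoint T pp hp2 hp3 hp5 hpl hpole' hord3 x₀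
  have h15 := GenuineK.fifteen_mul_prime_dvd_absRamificationIdx_kOf_mul_ratPoint T pp hp2 hpl ht hpole x₀
  have h2 := GenuineK.two_mul_prime_dvd_absRamificationIdx_kOf_of_isSquare T pp hp2 hpl hpole' hsq hodd x₀
  have hle := GenuineK.prime_dvd_absRamificationIdx_kOf_ratPoint T pp hp2 hpl hpole' x₀
  have hlow := mul_mul_dvd_of_sandwich (a := 2) (b := 5) T.D.l_prime.pos hle h2 h15 (by norm_num) h5t (by norm_num)
  exact Nat.dvd_antisymm hup (by simpa [show 2 * 5 * l = 10 * l by ring] using hlow)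

/-- **EXACT tame type, class `5 ∣ t`, `3 ∤ t`, with the twist clause ⟹ `e(K_{x₀}/ℚ_p) = 6·l`** (sandwich: Tate-exact `e ∣ 6·l`,
abc-iut-w5-d236's `…_dvd_six_mul_ratPoint`, against `3·l ∣ e` from the Tate root and the twist factor `2`).
[cite: SilvermanATAEC1994, V.5 Thm. 5.3 and Cor. 5.4] [cite: Mochizuki2012, IUTchI Ex. 3.2 (iv) p. 71] [claim: Mochizuki2012, status: disputed] -/
theorem GenuineK.absRamificationIdx_kOf_eq_six_mul_of_isSquare (h5 : 5 ∣ t) (h3t : Nat.Coprime 3 t)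
    {y : ℚ} (hsq : letI := T.instFieldF; letI := T.instAlgebraF; IsSquare (algebraMap (ratPoint q).F T.F y))
    (hodd : ∀ v : HeightOneSpectrum (𝓞 ℚ), Rat.HeightOneSpectrum.natGenerator v = pp → Odd (Literature.IUT.LogVolume.ord ℚ v y)) :
    letI := T.instFieldF; letI := T.instNumberFieldF; letI := T.instAlgebraF; letI := T.instFieldK
    letI := T.instNumberFieldK; letI := T.instAlgebraK; letI := T.instFieldFbar; letI := T.instAlgebraFbar
    letI := T.instAlgebraKFbar; letI := T.instIsElliptic
    haveI : Fact (pp : ℕ).Prime := ⟨pp.2⟩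
    ∀ x₀ : (thetaIndex (pilotDataOfK T.D T.K)).Fibre (.inr pp),
      absRamificationIdx (pp : ℕ) (kOf (pilotDataOfK T.D T.K) pp.1 x₀) = 6 * l := by
  letI := T.instFieldF; letI := T.instNumberFieldF; letI := T.instAlgebraF; letI := T.instFieldK
  letI := T.instNumberFieldK; letI := T.instAlgebraK; letI := T.instFieldFbar; letI := T.instAlgebraFbar
  letI := T.instAlgebraKFbar; letI := T.instIsElliptic
  haveI : Fact (pp : ℕ).Prime := ⟨pp.2⟩
  intro x₀
  have hpole' := pole_neg pp ht hpole
  have hord5 : ∀ v : HeightOneSpectrum (𝓞 ℚ), Rat.HeightOneSpectrum.natGenerator v = pp →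
      (5 : ℤ) ∣ Literature.IUT.LogVolume.ord ℚ v (Cor22.jInv q) := fun v hv => by
    obtain ⟨t', ht'⟩ := h5
    refine ⟨-(2 * (t' : ℤ)), ?_⟩
    rw [hpole v hv, ht']; push_cast; ring
  have hup := GenuineK.absRamificationIdx_kOf_dvd_six_mul_ratPoint T pp hp2 hp3 hp5 hpl hpole' hord5 x₀
  have h15 := GenuineK.fifteen_mul_prime_dvd_absRamificationIdx_kOf_mul_ratPoint T pp hp2 hpl ht hpole x₀
  have h2 := GenuineK.two_mul_prime_dvd_absRamificationIdx_kOf_of_isSquare T pp hp2 hpl hpole' hsq hodd x₀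
  have hle := GenuineK.prime_dvd_absRamificationIdx_kOf_ratPoint T pp hp2 hpl hpole' x₀
  have hlow := mul_mul_dvd_of_sandwich (a := 2) (b := 3) T.D.l_prime.pos hle h2 h15 (by norm_num) h3t (by norm_num)
  exact Nat.dvd_antisymm hup (by simpa [show 2 * 3 * l = 6 * l by ring] using hlow)

/-- **EXACT tame type, class `15 ∣ t`, with the twist clause ⟹ `e(K_{x₀}/ℚ_p) = 2·l`** (sandwich: Tate-exact `e ∣ 2·l`,
abc-iut-w5-d236's `…_dvd_two_mul_ratPoint`, against the twist factor `2` and the exact `l`).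
[cite: SilvermanATAEC1994, V.5 Thm. 5.3 and Cor. 5.4] [cite: Mochizuki2012, IUTchI Ex. 3.2 (iv) p. 71] [claim: Mochizuki2012, status: disputed] -/
theorem GenuineK.absRamificationIdx_kOf_eq_two_mul_of_isSquare (h15t : 15 ∣ t)
    {y : ℚ} (hsq : letI := T.instFieldF; letI := T.instAlgebraF; IsSquare (algebraMap (ratPoint q).F T.F y))
    (hodd : ∀ v : HeightOneSpectrum (𝓞 ℚ), Rat.HeightOneSpectrum.natGenerator v = pp → Odd (Literature.IUT.LogVolume.ord ℚ v y)) :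
    letI := T.instFieldF; letI := T.instNumberFieldF; letI := T.instAlgebraF; letI := T.instFieldK
    letI := T.instNumberFieldK; letI := T.instAlgebraK; letI := T.instFieldFbar; letI := T.instAlgebraFbar
    letI := T.instAlgebraKFbar; letI := T.instIsElliptic
    haveI : Fact (pp : ℕ).Prime := ⟨pp.2⟩
    ∀ x₀ : (thetaIndex (pilotDataOfK T.D T.K)).Fibre (.inr pp),
      absRamificationIdx (pp : ℕ) (kOf (pilotDataOfK T.D T.K) pp.1 x₀) = 2 * l := by
  letI := T.instFieldF; letI := T.instNumberFieldF; letI := T.instAlgebraF; letI := T.instFieldK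
  letI := T.instNumberFieldK; letI := T.instAlgebraK; letI := T.instFieldFbar; letI := T.instAlgebraFbar
  letI := T.instAlgebraKFbar; letI := T.instIsElliptic
  haveI : Fact (pp : ℕ).Prime := ⟨pp.2⟩
  intro x₀
  have hpole' := pole_neg pp ht hpole
  have hord15 : ∀ v : HeightOneSpectrum (𝓞 ℚ), Rat.HeightOneSpectrum.natGenerator v = pp →
      (15 : ℤ) ∣ Literature.IUT.LogVolume.ord ℚ v (Cor22.jInv q) := fun v hv => by
    obtain ⟨t', ht'⟩ := h15t
    refine ⟨-(2 * (t' : ℤ)), ?_⟩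
    rw [hpole v hv, ht']; push_cast; ring
  have hup := GenuineK.absRamificationIdx_kOf_dvd_two_mul_ratPoint T pp hp2 hp3 hp5 hpl hpole' hord15 x₀
  have h2 := GenuineK.two_mul_prime_dvd_absRamificationIdx_kOf_of_isSquare T pp hp2 hpl hpole' hsq hodd x₀
  exact Nat.dvd_antisymm hup h2

/-- **The two Kummer candidates WITHOUT the model clause: `gcd(15, t) = 1` ⟹ `e(K_{x₀}/ℚ_p) = 15·l ∨ e(K_{x₀}/ℚ_p) = 30·l`** at every
fibre point over a rational pole `p ∉ {2,3,5,l}` of `j` (sandwich `15·l ∣ e ∣ 30·l`; e.g. `e ∈ {195, 390}` over `283` at the R-W row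
`283 + 5¹¹·13² = 2⁸·3⁸·17³`, `l = 13`). Which one occurs depends on the field `F` of the datum (twists), not on the typed data alone.
[cite: Mochizuki2012, IUTchIV Thm. 1.10 proof Steps (ii)–(iii) p. 24–26] [cite: SerreLocalFields1979, Ch. IV §2 Cor. 1 of Prop. 7]
[claim: Mochizuki2012, status: disputed] -/
theorem GenuineK.absRamificationIdx_kOf_eq_fifteen_mul_or_eq_thirty_mul (hcop : Nat.Coprime 15 t) :
    letI := T.instFieldF; letI := T.instNumberFieldF; letI := T.instAlgebraF; letI := T.instFieldK
    letI := T.instNumberFieldK; letI := T.instAlgebraK; letI := T.instFieldFbar; letI := T.instAlgebraFbar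
    letI := T.instAlgebraKFbar; letI := T.instIsElliptic
    haveI : Fact (pp : ℕ).Prime := ⟨pp.2⟩
    ∀ x₀ : (thetaIndex (pilotDataOfK T.D T.K)).Fibre (.inr pp),
      absRamificationIdx (pp : ℕ) (kOf (pilotDataOfK T.D T.K) pp.1 x₀) = 15 * l ∨
        absRamificationIdx (pp : ℕ) (kOf (pilotDataOfK T.D T.K) pp.1 x₀) = 30 * l := by
  letI := T.instFieldF; letI := T.instNumberFieldF; letI := T.instAlgebraF; letI := T.instFieldK
  letI := T.instNumberFieldK; letI := T.instAlgebraK; letI := T.instFieldFbar; letI := T.instAlgebraFbar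
  letI := T.instAlgebraKFbar; letI := T.instIsElliptic
  haveI : Fact (pp : ℕ).Prime := ⟨pp.2⟩
  intro x₀
  have hpole' := pole_neg pp ht hpole
  have hup := (GenuineK.absRamificationIdx_kOf_dvd_thirty_mul_ratPoint T pp hp2 hp3 hp5 hpl hpole' x₀).1
  have h15 := GenuineK.fifteen_mul_prime_dvd_absRamificationIdx_kOf_ratPoint_of_coprime T pp hp2 hpl ht hcop hpole x₀
  set e := absRamificationIdx (pp : ℕ) (kOf (pilotDataOfK T.D T.K) pp.1 x₀) with he
  obtain ⟨k, hk⟩ := h15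
  have hl0 : 0 < 15 * l := Nat.mul_pos (by norm_num) T.D.l_prime.pos
  have hk2 : k ∣ 2 := by
    have : 15 * l * k ∣ 15 * l * 2 := by rw [← hk, show 15 * l * 2 = 30 * l by ring]; exact hup
    exact Nat.dvd_of_mul_dvd_mul_left hl0 this
  have hk' : k = 1 ∨ k = 2 := by
    have hkle : k ≤ 2 := Nat.le_of_dvd (by norm_num) hk2
    have hk0 : k ≠ 0 := by
      rintro rfl
      have : e = 0 := by rw [hk]; ring
      have hpos : 0 < e := by
        rw [he]
        exact absRamificationIdx_pos _ _
      omega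
    omega
  rcases hk' with rfl | rfl
  · left; rw [hk]; ring
  · right; rw [hk]; ring

/-! ### v2 (append): the two Kummer candidates `{m·l, 2m·l}`, `m = 15/gcd(15,t)`, in the classes `3 ∣ t`, `5 ∣ t`,
`15 ∣ t`, with NO model clause (sandwich of the Tate-exact upper bounds and the Tate-root lower bound). -/


/-- **The two Kummer candidates, class `3 ∣ t`, `5 ∤ t`, NO model clause: `e(K_{x₀}/ℚ_p) = 5·l ∨ e(K_{x₀}/ℚ_p) = 10·l`**
(sandwich `5·l ∣ e ∣ 10·l`; e.g. `{65, 130}` over `17` at `283 + 5¹¹·13² = 2⁸·3⁸·17³`, `l = 13`).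
[cite: SilvermanATAEC1994, V.5 Thm. 5.3 and Cor. 5.4] [cite: Mochizuki2012, IUTchI Ex. 3.2 (iv) p. 71] [claim: Mochizuki2012, status: disputed] -/
theorem GenuineK.absRamificationIdx_kOf_eq_five_mul_or_eq_ten_mul (h3 : 3 ∣ t) (h5t : Nat.Coprime 5 t) :
    letI := T.instFieldF; letI := T.instNumberFieldF; letI := T.instAlgebraF; letI := T.instFieldK
    letI := T.instNumberFieldK; letI := T.instAlgebraK; letI := T.instFieldFbar; letI := T.instAlgebraFbar
    letI := T.instAlgebraKFbar; letI := T.instIsElliptic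
    haveI : Fact (pp : ℕ).Prime := ⟨pp.2⟩
    ∀ x₀ : (thetaIndex (pilotDataOfK T.D T.K)).Fibre (.inr pp),
      absRamificationIdx (pp : ℕ) (kOf (pilotDataOfK T.D T.K) pp.1 x₀) = 5 * l ∨
        absRamificationIdx (pp : ℕ) (kOf (pilotDataOfK T.D T.K) pp.1 x₀) = 10 * l := by
  letI := T.instFieldF; letI := T.instNumberFieldF; letI := T.instAlgebraF; letI := T.instFieldK
  letI := T.instNumberFieldK; letI := T.instAlgebraK; letI := T.instFieldFbar; letI := T.instAlgebraFbar
  letI := T.instAlgebraKFbar; letI := T.instIsElliptic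
  haveI : Fact (pp : ℕ).Prime := ⟨pp.2⟩
  intro x₀
  have hpole' := pole_neg pp ht hpole
  have hord3 : ∀ v : HeightOneSpectrum (𝓞 ℚ), Rat.HeightOneSpectrum.natGenerator v = pp →
      (3 : ℤ) ∣ Literature.IUT.LogVolume.ord ℚ v (Cor22.jInv q) := fun v hv => by
    obtain ⟨t', ht'⟩ := h3
    refine ⟨-(2 * (t' : ℤ)), ?_⟩
    rw [hpole v hv, ht']; push_cast; ring
  have hup := GenuineK.absRamificationIdx_kOf_dvd_ten_mul_ratPoint T pp hp2 hp3 hp5 hpl hpole' hord3 x₀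
  have h15 := GenuineK.fifteen_mul_prime_dvd_absRamificationIdx_kOf_mul_ratPoint T pp hp2 hpl ht hpole x₀
  have hle := GenuineK.prime_dvd_absRamificationIdx_kOf_ratPoint T pp hp2 hpl hpole' x₀
  have hlow := mul_mul_dvd_of_sandwich (a := 1) (b := 5) T.D.l_prime.pos hle (by simpa using hle) h15 (by norm_num) h5t
    (Nat.coprime_one_left 5)
  have hlow' : 5 * l ∣ absRamificationIdx (pp : ℕ) (kOf (pilotDataOfK T.D T.K) pp.1 x₀) := by
    simpa [show 1 * 5 * l = 5 * l by ring] using hlow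
  have := eq_or_eq_two_mul_of_dvd_of_dvd (Nat.mul_pos (by norm_num) T.D.l_prime.pos) hlow'
    (by simpa [show 2 * (5 * l) = 10 * l by ring] using hup)
  simpa [show 2 * (5 * l) = 10 * l by ring] using this

/-- **The two Kummer candidates, class `5 ∣ t`, `3 ∤ t`, NO model clause: `e(K_{x₀}/ℚ_p) = 3·l ∨ e(K_{x₀}/ℚ_p) = 6·l`**
(sandwich `3·l ∣ e ∣ 6·l`). [cite: SilvermanATAEC1994, V.5 Thm. 5.3 and Cor. 5.4] [cite: Mochizuki2012, IUTchI Ex. 3.2 (iv) p. 71] [claim: Mochizuki2012, status: disputed] -/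
theorem GenuineK.absRamificationIdx_kOf_eq_three_mul_or_eq_six_mul (h5 : 5 ∣ t) (h3t : Nat.Coprime 3 t) :
    letI := T.instFieldF; letI := T.instNumberFieldF; letI := T.instAlgebraF; letI := T.instFieldK
    letI := T.instNumberFieldK; letI := T.instAlgebraK; letI := T.instFieldFbar; letI := T.instAlgebraFbar
    letI := T.instAlgebraKFbar; letI := T.instIsElliptic
    haveI : Fact (pp : ℕ).Prime := ⟨pp.2⟩
    ∀ x₀ : (thetaIndex (pilotDataOfK T.D T.K)).Fibre (.inr pp),
      absRamificationIdx (pp : ℕ) (kOf (pilotDataOfK T.D T.K) pp.1 x₀) = 3 * l ∨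
        absRamificationIdx (pp : ℕ) (kOf (pilotDataOfK T.D T.K) pp.1 x₀) = 6 * l := by
  letI := T.instFieldF; letI := T.instNumberFieldF; letI := T.instAlgebraF; letI := T.instFieldK
  letI := T.instNumberFieldK; letI := T.instAlgebraK; letI := T.instFieldFbar; letI := T.instAlgebraFbar
  letI := T.instAlgebraKFbar; letI := T.instIsElliptic
  haveI : Fact (pp : ℕ).Prime := ⟨pp.2⟩
  intro x₀
  have hpole' := pole_neg pp ht hpole
  have hord5 : ∀ v : HeightOneSpectrum (𝓞 ℚ), Rat.HeightOneSpectrum.natGenerator v = pp →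
      (5 : ℤ) ∣ Literature.IUT.LogVolume.ord ℚ v (Cor22.jInv q) := fun v hv => by
    obtain ⟨t', ht'⟩ := h5
    refine ⟨-(2 * (t' : ℤ)), ?_⟩
    rw [hpole v hv, ht']; push_cast; ring
  have hup := GenuineK.absRamificationIdx_kOf_dvd_six_mul_ratPoint T pp hp2 hp3 hp5 hpl hpole' hord5 x₀
  have h15 := GenuineK.fifteen_mul_prime_dvd_absRamificationIdx_kOf_mul_ratPoint T pp hp2 hpl ht hpole x₀
  have hle := GenuineK.prime_dvd_absRamificationIdx_kOf_ratPoint T pp hp2 hpl hpole' x₀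
  have hlow := mul_mul_dvd_of_sandwich (a := 1) (b := 3) T.D.l_prime.pos hle (by simpa using hle) h15 (by norm_num) h3t
    (Nat.coprime_one_left 3)
  have hlow' : 3 * l ∣ absRamificationIdx (pp : ℕ) (kOf (pilotDataOfK T.D T.K) pp.1 x₀) := by
    simpa [show 1 * 3 * l = 3 * l by ring] using hlow
  have := eq_or_eq_two_mul_of_dvd_of_dvd (Nat.mul_pos (by norm_num) T.D.l_prime.pos) hlow'
    (by simpa [show 2 * (3 * l) = 6 * l by ring] using hup)
  simpa [show 2 * (3 * l) = 6 * l by ring] using this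

/-- **The two Kummer candidates, class `15 ∣ t`, NO model clause: `e(K_{x₀}/ℚ_p) = l ∨ e(K_{x₀}/ℚ_p) = 2·l`** (sandwich
`l ∣ e ∣ 2·l`). [cite: SilvermanATAEC1994, V.5 Thm. 5.3 and Cor. 5.4] [cite: Mochizuki2012, IUTchI Ex. 3.2 (iv) p. 71] [claim: Mochizuki2012, status: disputed] -/
theorem GenuineK.absRamificationIdx_kOf_eq_or_eq_two_mul (h15t : 15 ∣ t) :
    letI := T.instFieldF; letI := T.instNumberFieldF; letI := T.instAlgebraF; letI := T.instFieldK
    letI := T.instNumberFieldK; letI := T.instAlgebraK; letI := T.instFieldFbar; letI := T.instAlgebraFbar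
    letI := T.instAlgebraKFbar; letI := T.instIsElliptic
    haveI : Fact (pp : ℕ).Prime := ⟨pp.2⟩
    ∀ x₀ : (thetaIndex (pilotDataOfK T.D T.K)).Fibre (.inr pp),
      absRamificationIdx (pp : ℕ) (kOf (pilotDataOfK T.D T.K) pp.1 x₀) = l ∨
        absRamificationIdx (pp : ℕ) (kOf (pilotDataOfK T.D T.K) pp.1 x₀) = 2 * l := by
  letI := T.instFieldF; letI := T.instNumberFieldF; letI := T.instAlgebraF; letI := T.instFieldK
  letI := T.instNumberFieldK; letI := T.instAlgebraK; letI := T.instFieldFbar; letI := T.instAlgebraFbar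
  letI := T.instAlgebraKFbar; letI := T.instIsElliptic
  haveI : Fact (pp : ℕ).Prime := ⟨pp.2⟩
  intro x₀
  have hpole' := pole_neg pp ht hpole
  have hord15 : ∀ v : HeightOneSpectrum (𝓞 ℚ), Rat.HeightOneSpectrum.natGenerator v = pp →
      (15 : ℤ) ∣ Literature.IUT.LogVolume.ord ℚ v (Cor22.jInv q) := fun v hv => by
    obtain ⟨t', ht'⟩ := h15t
    refine ⟨-(2 * (t' : ℤ)), ?_⟩
    rw [hpole v hv, ht']; push_cast; ring
  have hup := GenuineK.absRamificationIdx_kOf_dvd_two_mul_ratPoint T pp hp2 hp3 hp5 hpl hpole' hord15 x₀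
  have hle := GenuineK.prime_dvd_absRamificationIdx_kOf_ratPoint T pp hp2 hpl hpole' x₀
  exact eq_or_eq_two_mul_of_dvd_of_dvd T.D.l_prime.pos hle hup

end Tame

end Summit.ABC.IUTFork.Conditional

end
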